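import Summits.Ventures.PercRepro.RankLevelSetTightPairsS

/-!
# PercRepro — [re-pointed at the primed (`_S`) parents per (um)(35)(2)–(4); the landed originals are the citations]
# THE TAILS OF A PARTITION: `(p − q)·b″(e) ≤ #xSets_S` (night-1, gen 9; §19.6)

On the tight layer `|E| = p + q`, for an independent `p`-set `A ∋ e` with `Ā = E ∖ A` independent and
`e ∈ cl(Ā)` (the partitions counted by `b″(e)`, `bSets`), extend `Ā` to a basis of `Ā ∪ (A ∖ e)` — which spans
`A` since `e ∈ cl(Ā)` — to find `≥ p − q` sets `T ⊆ A ∖ e` of size `p − q − 1` with `Ā ∪ T` independent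
(`goodTails`, `le_card_goodTails`).  Each gives the dependent `p`-set `insert e (Ā ∪ T)` with independent
`e`-free part (`tailImage_subset_xSets`); when every circuit through `e` has `≥ q + 1` elements,
`insert e Ā` is a circuit, the unique one inside its `X` (`circuit_eq_of_subset_xSet`), so the images of
distinct partitions are disjoint (`tailImage_pairwiseDisjoint`).  Hence

* **`mul_card_bSets_le_card_xSets`** — `(p − q) · #bSets ≤ #xSets_S`.

Axioms: standard.
-/

open scoped Matroid

namespace PercRepro

open Set Finset
open scoped Classical

variable {α : Type} (M : Matroid α) [M.Finite]

/-- The partitions counted by `b″(e)`: independent `p`-sets `A ∋ e` with `E ∖ A` independent and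
`e ∈ cl(E ∖ A)` (as `Finset`s). -/
noncomputable def bSets (e : α) (p : ℕ) : Finset (Finset α) :=
  (indepSets M p).filter (fun A : Finset α => e ∈ A ∧
    M.Indep ((groundFinset_S M \ A : Finset α) : Set α) ∧ e ∈ M.closure ((groundFinset_S M \ A : Finset α) : Set α))

/-- The good tails of `A`: `T ⊆ A.erase e` with `|T| = p − q − 1` and `(E ∖ A) ∪ T` independent. -/
noncomputable def goodTails (e : α) (p q : ℕ) (A : Finset α) : Finset (Finset α) :=
  ((A.erase e).powersetCard (p - q - 1)).filter
    (fun T : Finset α => M.Indep (((groundFinset_S M \ A) ∪ T : Finset α) : Set α))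

/-- The coercion of `groundFinset_S M \ A`. -/
lemma coe_ground_sdiff (A : Finset α) :
    ((groundFinset_S M \ A : Finset α) : Set α) = M.E \ (A : Set α) := by
  rw [Finset.coe_sdiff]
  congr 1
  exact (M.set_finite M.E).coe_toFinset

/-- On the tight layer `|E| = p + q`, `E ∖ A` has `q` elements for an independent `p`-set `A`. -/
lemma card_ground_sdiff {p q : ℕ} (hE : M.E.ncard = p + q) {A : Finset α} (hA : A ∈ indepSets M p) :
    (groundFinset_S M \ A).card = q := by
  rw [mem_indepSets M] at hA
  obtain ⟨hAE, hAp, -⟩ := hA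
  rw [Finset.card_sdiff_of_subset hAE, hAp]
  have : (groundFinset_S M).card = p + q := by
    rw [← hE]
    exact (ncard_eq_toFinset_card _ (M.set_finite M.E)).symm
  rw [this]
  omega

/-- At least `p − q` good tails: extend `E ∖ A` to a basis of `(E ∖ A) ∪ (A ∖ e)`, which spans `A`
(`e ∈ cl(E ∖ A)`), so the basis has `≥ p` elements and `≥ p − q` of them lie in `A ∖ e`; every
`(p − q − 1)`-subset of those is a good tail. -/
lemma le_card_goodTails {e : α} {p q : ℕ} (hE : M.E.ncard = p + q) (hq : q + 1 ≤ p)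
    {A : Finset α} (hA : A ∈ bSets M e p) : p - q ≤ (goodTails M e p q A).card := by
  have hEfin : M.E.Finite := M.set_finite M.E
  unfold bSets at hA
  rw [Finset.mem_filter] at hA
  obtain ⟨hAind, heA, hĀind, hecl⟩ := hA
  have hAq := card_ground_sdiff M hE hAind
  rw [mem_indepSets M] at hAind
  obtain ⟨hAE, hAp, hAindep⟩ := hAind
  set Ā : Finset α := groundFinset_S M \ A with hĀ
  -- the set `Y = Ā ∪ (A ∖ e)` spans `A`
  set Y : Set α := (Ā : Set α) ∪ ((A.erase e : Finset α) : Set α) with hY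
  have hYE : Y ⊆ M.E := by
    rw [hY, coe_ground_sdiff]
    refine Set.union_subset Set.sdiff_subset ?_
    intro x hx
    rw [Finset.mem_coe, Finset.mem_erase] at hx
    have := hAE hx.2
    rwa [hEfin.mem_toFinset] at this
  have hAcl : (A : Set α) ⊆ M.closure Y := by
    intro x hx
    by_cases hxe : x = e
    · subst hxe
      exact M.closure_subset_closure (Set.subset_union_left) hecl
    · apply M.subset_closure Y hYE
      right
      rw [Finset.mem_coe, Finset.mem_erase]
      exact ⟨hxe, hx⟩
  -- a basis `J` of `Y` containing `Ā`
  obtain ⟨J, hJ, hĀJ⟩ := hĀind.subset_isBasis_of_subset (Set.subset_union_left (t := ((A.erase e : Finset α) : Set α))) hYE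
  have hJcard : ((p : ℕ) : ℕ∞) ≤ J.encard := by
    rw [hJ.encard_eq_eRk, ← M.eRk_closure_eq Y]
    calc ((p : ℕ) : ℕ∞) = (A : Set α).encard := by
          rw [encard_coe_eq_coe_finsetCard, hAp]
      _ = M.eRk (A : Set α) := hAindep.eRk_eq_encard.symm
      _ ≤ M.eRk (M.closure Y) := M.eRk_mono hAcl
  have hJfin : J.Finite := hEfin.subset hJ.indep.subset_ground
  -- the part of `J` in `A ∖ e`
  set S : Finset α := hJfin.toFinset \ Ā with hS
  have hSsub : S ⊆ A.erase e := by
    intro x hx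
    rw [hS, Finset.mem_sdiff, hJfin.mem_toFinset] at hx
    have := hJ.subset hx.1
    rcases this with h | h
    · exact absurd (Finset.mem_coe.1 h) hx.2
    · exact Finset.mem_coe.1 h
  have hScard : p - q ≤ S.card := by
    have h1 : (hJfin.toFinset \ Ā).card + Ā.card = hJfin.toFinset.card := by
      apply Finset.card_sdiff_add_card_eq_card
      intro x hx
      rw [hJfin.mem_toFinset]
      exact hĀJ (Finset.mem_coe.2 hx)
    have h2 : p ≤ hJfin.toFinset.card := by
      rw [← ncard_eq_toFinset_card J hJfin]
      have := hJcard
      rw [← hJfin.cast_ncard_eq] at this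
      exact_mod_cast this
    rw [hS]
    omega
  -- choose `p − q` of them; their `(p − q − 1)`-subsets `S₀.erase t` are good tails
  obtain ⟨S₀, hS₀S, hS₀card⟩ := Finset.exists_subset_card_eq hScard
  have himg : S₀.image (fun t => S₀.erase t) ⊆ goodTails M e p q A := by
    intro T hT
    rw [Finset.mem_image] at hT
    obtain ⟨t, ht, rfl⟩ := hT
    unfold goodTails
    rw [Finset.mem_filter, Finset.mem_powersetCard]
    refine ⟨⟨(Finset.erase_subset t S₀).trans (hS₀S.trans hSsub), ?_⟩, ?_⟩
    · rw [Finset.card_erase_of_mem ht, hS₀card]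
    · refine hJ.indep.subset ?_
      intro x hx
      rw [Finset.coe_union, Set.mem_union] at hx
      rcases hx with hx | hx
      · exact hĀJ hx
      · have := hS₀S (Finset.mem_of_mem_erase (Finset.mem_coe.1 hx))
        rw [hS, Finset.mem_sdiff, hJfin.mem_toFinset] at this
        exact this.1
  calc p - q = S₀.card := hS₀card.symm
    _ = (S₀.image (fun t => S₀.erase t)).card := by
        rw [Finset.card_image_of_injOn]
        intro a ha b hb hab
        exact (Finset.erase_inj S₀ ha).1 hab
    _ ≤ (goodTails M e p q A).card := Finset.card_le_card himg

/-- Two circuits inside a member of `xSets_S` coincide (elimination would put a circuit inside the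
independent `X.erase e`). -/
lemma circuit_eq_of_subset_xSet {e : α} {p : ℕ} {X : Finset α} (hX : X ∈ xSets_S M e p)
    {C₁ C₂ : Set α} (hC₁ : M.IsCircuit C₁) (hC₂ : M.IsCircuit C₂)
    (hC₁X : C₁ ⊆ (X : Set α)) (hC₂X : C₂ ⊆ (X : Set α)) : C₁ = C₂ := by
  rw [mem_xSets_iff_S] at hX
  obtain ⟨-, -, -, hind, -⟩ := hX
  by_contra hne
  obtain ⟨C, hCsub, hC⟩ := hC₁.elimination hC₂ hne e
  apply hC.not_indep
  refine hind.subset (hCsub.trans ?_)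
  intro x hx
  obtain ⟨hx1, hx2⟩ := hx
  rw [Set.mem_singleton_iff] at hx2
  rw [Finset.coe_erase, Set.mem_sdiff, Set.mem_singleton_iff]
  refine ⟨?_, hx2⟩
  rcases hx1 with h | h
  · exact hC₁X h
  · exact hC₂X h

/-- For `A ∈ bSets`, `insert e (E ∖ A)` is a circuit when every circuit through `e` has `≥ q + 1` elements
(on the tight layer `|E ∖ A| = q`). -/
lemma isCircuit_insert_ground_sdiff {e : α} {p q : ℕ} (hE : M.E.ncard = p + q) {A : Finset α}
    (hA : A ∈ bSets M e p)
    (hc : ∀ C : Set α, M.IsCircuit C → e ∈ C → ((q + 1 : ℕ) : ℕ∞) ≤ C.encard) :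
    M.IsCircuit (insert e ((groundFinset_S M \ A : Finset α) : Set α)) := by
  unfold bSets at hA
  rw [Finset.mem_filter] at hA
  obtain ⟨hAind, heA, hĀind, hecl⟩ := hA
  have hĀq := card_ground_sdiff M hE hAind
  have heĀ : e ∉ ((groundFinset_S M \ A : Finset α) : Set α) := by
    rw [Finset.mem_coe, Finset.mem_sdiff]
    exact fun h => h.2 heA
  have hC := hĀind.fundCircuit_isCircuit hecl heĀ
  have hsub := M.fundCircuit_subset_insert e ((groundFinset_S M \ A : Finset α) : Set α)
  have hle := hc _ hC (M.mem_fundCircuit e _)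
  have hcard : (insert e ((groundFinset_S M \ A : Finset α) : Set α)).encard = ((q + 1 : ℕ) : ℕ∞) := by
    rw [encard_insert_of_notMem heĀ, encard_coe_eq_coe_finsetCard, hĀq]
    push_cast
    rfl
  have heq := (hC.finite).eq_of_subset_of_encard_le hsub (by rw [hcard]; exact hle)
  rw [← heq]
  exact hC

/-- The image of the good tails of `A`: the dependent `p`-sets `insert e ((E ∖ A) ∪ T)`. -/
noncomputable def tailImage (e : α) (p q : ℕ) (A : Finset α) : Finset (Finset α) :=
  (goodTails M e p q A).image (fun T => insert e ((groundFinset_S M \ A) ∪ T))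

/-- `tailImage A ⊆ xSets_S` for `A ∈ bSets` on the tight layer. -/
lemma tailImage_subset_xSets {e : α} {p q : ℕ} (hE : M.E.ncard = p + q) (hq : q + 1 ≤ p)
    {A : Finset α} (hA : A ∈ bSets M e p) : tailImage M e p q A ⊆ xSets_S M e p := by
  have hEfin : M.E.Finite := M.set_finite M.E
  have hA' := hA
  unfold bSets at hA'
  rw [Finset.mem_filter] at hA'
  obtain ⟨hAind, heA, hĀind, hecl⟩ := hA'
  have hĀq := card_ground_sdiff M hE hAind
  rw [mem_indepSets M] at hAind
  obtain ⟨hAE, hAp, -⟩ := hAind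
  intro X hX
  unfold tailImage at hX
  rw [Finset.mem_image] at hX
  obtain ⟨T, hT, rfl⟩ := hX
  unfold goodTails at hT
  rw [Finset.mem_filter, Finset.mem_powersetCard] at hT
  obtain ⟨⟨hTA, hTcard⟩, hTind⟩ := hT
  have heT : e ∉ T := fun h => Finset.notMem_erase e A (hTA h)
  have heĀ : e ∉ groundFinset_S M \ A := by
    rw [Finset.mem_sdiff]
    exact fun h => h.2 heA
  have hdisj : Disjoint (groundFinset_S M \ A) T := by
    rw [Finset.disjoint_left]
    intro x hx hxT
    rw [Finset.mem_sdiff] at hx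
    exact hx.2 (Finset.mem_of_mem_erase (hTA hxT))
  have heU : e ∉ (groundFinset_S M \ A) ∪ T := by
    rw [Finset.mem_union]
    exact fun h => h.elim heĀ heT
  rw [mem_xSets_iff_S]
  refine ⟨?_, ?_, Finset.mem_insert_self e _, ?_, ?_⟩
  · intro x hx
    rw [Finset.mem_insert, Finset.mem_union, Finset.mem_sdiff] at hx
    rcases hx with rfl | hx | hx
    · exact hAE heA
    · exact hx.1
    · exact hAE (Finset.mem_of_mem_erase (hTA hx))
  · rw [Finset.card_insert_of_notMem heU, Finset.card_union_of_disjoint hdisj, hĀq, hTcard]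
    omega
  · rw [Finset.erase_insert heU]
    exact hTind
  · intro hind
    have hdep : ¬ M.Indep (insert e ((groundFinset_S M \ A : Finset α) : Set α)) := by
      rw [hĀind.insert_indep_iff_of_notMem (by rw [Finset.mem_coe]; exact heĀ)]
      exact fun h => h.2 hecl
    apply hdep
    refine hind.subset ?_
    rw [Finset.coe_insert]
    exact Set.insert_subset_insert (by
      rw [Finset.coe_union]
      exact Set.subset_union_left)

/-- `T ↦ insert e ((E ∖ A) ∪ T)` is injective on the good tails of `A`. -/
lemma card_tailImage {e : α} {p q : ℕ} {A : Finset α} (heA : e ∈ A) :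
    (tailImage M e p q A).card = (goodTails M e p q A).card := by
  unfold tailImage
  rw [Finset.card_image_of_injOn]
  intro T₁ hT₁ T₂ hT₂ hEq
  rw [Finset.mem_coe] at hT₁ hT₂
  unfold goodTails at hT₁ hT₂
  rw [Finset.mem_filter, Finset.mem_powersetCard] at hT₁ hT₂
  have heĀ : e ∉ groundFinset_S M \ A := by
    rw [Finset.mem_sdiff]
    exact fun h => h.2 heA
  have hdisj : ∀ T, T ⊆ A.erase e → Disjoint (groundFinset_S M \ A) T := by
    intro T hTA
    rw [Finset.disjoint_left]
    intro x hx hxT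
    rw [Finset.mem_sdiff] at hx
    exact hx.2 (Finset.mem_of_mem_erase (hTA hxT))
  have heU : ∀ T, T ⊆ A.erase e → e ∉ (groundFinset_S M \ A) ∪ T := by
    intro T hTA h
    rw [Finset.mem_union] at h
    exact h.elim heĀ (fun h => Finset.notMem_erase e A (hTA h))
  have h1 : (groundFinset_S M \ A) ∪ T₁ = (groundFinset_S M \ A) ∪ T₂ := by
    have := congrArg (fun X : Finset α => X.erase e) hEq
    simp only at this
    rwa [Finset.erase_insert (heU T₁ hT₁.1.1), Finset.erase_insert (heU T₂ hT₂.1.1)] at this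
  have h2 : ((groundFinset_S M \ A) ∪ T₁) \ (groundFinset_S M \ A) =
      ((groundFinset_S M \ A) ∪ T₂) \ (groundFinset_S M \ A) := by rw [h1]
  rwa [Finset.union_sdiff_cancel_left (hdisj T₁ hT₁.1.1),
    Finset.union_sdiff_cancel_left (hdisj T₂ hT₂.1.1)] at h2

/-- The tail images of distinct members of `bSets` are disjoint: a common `X` contains the circuits
`insert e (E ∖ A₁)` and `insert e (E ∖ A₂)`, which must coincide. -/
lemma tailImage_pairwiseDisjoint {e : α} {p q : ℕ} (hE : M.E.ncard = p + q) (hq : q + 1 ≤ p)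
    (hc : ∀ C : Set α, M.IsCircuit C → e ∈ C → ((q + 1 : ℕ) : ℕ∞) ≤ C.encard) :
    ((bSets M e p : Finset (Finset α)) : Set (Finset α)).PairwiseDisjoint (tailImage M e p q) := by
  intro A₁ hA₁ A₂ hA₂ hne
  rw [Finset.mem_coe] at hA₁ hA₂
  rw [Function.onFun, Finset.disjoint_left]
  intro X hX₁ hX₂
  have hXx := tailImage_subset_xSets M hE hq hA₁ hX₁
  have hC₁ := isCircuit_insert_ground_sdiff M hE hA₁ hc
  have hC₂ := isCircuit_insert_ground_sdiff M hE hA₂ hc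
  -- both circuits lie in `X`
  have hsub : ∀ A T, X = insert e ((groundFinset_S M \ A) ∪ T) →
      insert e ((groundFinset_S M \ A : Finset α) : Set α) ⊆ (X : Set α) := by
    intro A T hXeq
    rw [hXeq, Finset.coe_insert]
    exact Set.insert_subset_insert (by rw [Finset.coe_union]; exact Set.subset_union_left)
  unfold tailImage at hX₁ hX₂
  rw [Finset.mem_image] at hX₁ hX₂
  obtain ⟨T₁, -, hXeq₁⟩ := hX₁
  obtain ⟨T₂, -, hXeq₂⟩ := hX₂
  have heq := circuit_eq_of_subset_xSet M hXx hC₁ hC₂ (hsub A₁ T₁ hXeq₁.symm) (hsub A₂ T₂ hXeq₂.symm)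
  apply hne
  -- `insert e Ā₁ = insert e Ā₂` with `e ∉ Āᵢ` gives `Ā₁ = Ā₂`, hence `A₁ = A₂`
  have hA₁' := hA₁
  have hA₂' := hA₂
  unfold bSets at hA₁' hA₂'
  rw [Finset.mem_filter, mem_indepSets M] at hA₁' hA₂'
  have he₁ : e ∉ ((groundFinset_S M \ A₁ : Finset α) : Set α) := by
    rw [Finset.mem_coe, Finset.mem_sdiff]
    exact fun h => h.2 hA₁'.2.1
  have he₂ : e ∉ ((groundFinset_S M \ A₂ : Finset α) : Set α) := by
    rw [Finset.mem_coe, Finset.mem_sdiff]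
    exact fun h => h.2 hA₂'.2.1
  have h1 : insert e ((groundFinset_S M \ A₁ : Finset α) : Set α) \ {e} =
      insert e ((groundFinset_S M \ A₂ : Finset α) : Set α) \ {e} := by rw [heq]
  rw [insert_sdiff_self_of_notMem he₁, insert_sdiff_self_of_notMem he₂] at h1
  have h2 : groundFinset_S M \ A₁ = groundFinset_S M \ A₂ := by exact_mod_cast h1
  have h3 : groundFinset_S M \ (groundFinset_S M \ A₁) = groundFinset_S M \ (groundFinset_S M \ A₂) := by
    rw [h2]
  rwa [Finset.sdiff_sdiff_eq_self hA₁'.1.1, Finset.sdiff_sdiff_eq_self hA₂'.1.1] at h3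

/-- **CLAIM C**: on the tight layer, if every circuit through `e` has `≥ q + 1` elements, then
`(p − q) · #bSets ≤ #xSets_S`. -/
theorem mul_card_bSets_le_card_xSets {e : α} {p q : ℕ} (hE : M.E.ncard = p + q) (hq : q + 1 ≤ p)
    (hc : ∀ C : Set α, M.IsCircuit C → e ∈ C → ((q + 1 : ℕ) : ℕ∞) ≤ C.encard) :
    (p - q) * (bSets M e p).card ≤ (xSets_S M e p).card := by
  have hsub : (bSets M e p).biUnion (tailImage M e p q) ⊆ xSets_S M e p := by
    intro X hX
    rw [Finset.mem_biUnion] at hX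
    obtain ⟨A, hA, hX⟩ := hX
    exact tailImage_subset_xSets M hE hq hA hX
  calc (p - q) * (bSets M e p).card
      = ∑ A ∈ bSets M e p, (p - q) := by rw [Finset.sum_const, smul_eq_mul, mul_comm]
    _ ≤ ∑ A ∈ bSets M e p, (tailImage M e p q A).card := by
        refine Finset.sum_le_sum (fun A hA => ?_)
        have heA : e ∈ A := by
          unfold bSets at hA
          rw [Finset.mem_filter] at hA
          exact hA.2.1
        rw [card_tailImage M heA]
        exact le_card_goodTails M hE hq hA
    _ = ((bSets M e p).biUnion (tailImage M e p q)).card := by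
        rw [Finset.card_biUnion (tailImage_pairwiseDisjoint M hE hq hc)]
    _ ≤ (xSets_S M e p).card := Finset.card_le_card hsub

end PercRepro
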